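import Summits.HodgeConjecture.HodgeConjecture.Theses.EndoscopicMiddleDegree
import Summits.HodgeConjecture.HodgeConjecture.Theses.SupersingularIsotypicLift
import Literature.AlgebraicGeometry.HodgeTheory.ComplexGysinCorrespondence
import Literature.AlgebraicGeometry.HodgeTheory.GysinKernelProofs

/-!
# `IsotypicMiddleClassesAlgebraic` (stmt-HodgeConjecture-14301) · Negative · no kill short of ¬HC

Negative knowledge for the crux `EndoscopicMiddleDegree.IsotypicMiddleClassesAlgebraic` (route
EndoscopicMiddleDegree, rank 3). (1) CEILING: a refutation of the crux refutes the Hodge conjecture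
itself — indeed already its middle-degree case on the sector (`not_middleHC_of_not_crux`,
`not_hodgeConjecture_of_not_crux`): for `c` rational with `P c = c` and `P` of type `(n,n)`, `c` is a
rational `(n,n)`-class on the smooth projective `X` of the datum; Poincaré duality of `μ`,
`γ ∈ algebraicClasses`, rationality preservation and `1 ≤ m ≤ 2` are not used. It also refutes the
sibling crux LIFT of route SupersingularIsotypicLift (`not_lift_of_not_crux`). (2) BARE FORM: if the
statement is granted for ARBITRARY functions `P` with `(n,n)` values (not only correspondence actions),
it is middle-degree HC on the sector (`mem_algebraicClasses_of_bare`, `P ≡ c`): all slack between the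
crux and HC sits in the shape of `P`. (3) FLOOR: crux + a sector envelope (every rational `(n,n)`-class
is fixed by an admissible `P_γ`) give middle-degree HC on the sector (`mem_algebraicClasses_of_crux_of_enveloped`),
and crux + the route's `OrthogonalEnveloped` make every rational `(n,n)`-class cup-orthogonal to the
theta world algebraic (`mem_algebraicClasses_of_crux_of_orthogonalEnveloped`) — the kernel half of the
target. Disprover's work file: `Cruxes/IsotypicMiddleClassesAlgebraic/Disproof.lean` (F1, F2, F4).
Refuter seat refuter-cdisprove-stmt-HodgeConjecture-14301-0 (cdisprove cycle 1), 2026-08-16.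
-/

noncomputable section

-- The mandated namespace `Summit.<P>.<Sub>.Theorems.…` repeats `HodgeConjecture` (single-conjunct summit).
set_option linter.dupNamespace false

namespace Summit.HodgeConjecture.HodgeConjecture.Theorems.IsotypicMiddleClassesAlgebraic.Negative.NoKillShortOfHC

open CategoryTheory MonoidalCategory CartesianMonoidalCategory
open Literature.AlgebraicGeometry Literature.AlgebraicGeometry.HodgeTheory
  Literature.AlgebraicGeometry.ShimuraVarieties Literature.AlgebraicTopology.SingularHomology
open Summit.HodgeConjecture.HodgeConjecture.Theses.EndoscopicMiddleDegree
  (IsotypicMiddleClassesAlgebraic OrthogonalEnveloped)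
open Summit.HodgeConjecture.HodgeConjecture.Theses.SupersingularIsotypicLift (IsotypicClassesAlgebraic)

variable {m : ℕ} {X : Motives.SchemeOver ℂ}

/-- **Ceiling, sector form.** If the crux fails, then middle-degree HC fails ON THE SECTOR: some
compact arithmetic `2(m+1)`-ball quotient, `m ∈ {1,2}`, carries a rational `(m+1,m+1)`-class that is
not algebraic. (Proof of the contrapositive: `c = P c` is rational of type `(n,n)`.) [folklore] -/
theorem not_middleHC_of_not_crux (h : ¬ IsotypicMiddleClassesAlgebraic) :
    ¬ ∀ (m : ℕ) (X : Motives.SchemeOver ℂ), UnitaryBallQuotientDatum (2 * (m + 1)) X → 1 ≤ m →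
      m ≤ 2 → ∀ c : complexBetti X (2 * (m + 1)), IsRationalClass c →
        IsOfHodgeType (2 * (m + 1)) X (2 * (m + 1)) (m + 1) (m + 1) c →
          c ∈ algebraicClasses X (m + 1) := by
  intro hM
  refine h ?_
  intro μ _hμ m X D h1 h2 γ _hγ P _hPrat hPhodge c hc hPc
  exact hM m X D h1 h2 c hc (hPc ▸ hPhodge c)

/-- **Ceiling.** If the crux fails, the Hodge conjecture fails (`X` is smooth projective of dimension
`2(m+1)` by the datum). [cite: Deligne2000, §1] -/
theorem not_hodgeConjecture_of_not_crux (h : ¬ IsotypicMiddleClassesAlgebraic) :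
    ¬ _root_.HodgeConjecture := by
  intro hHC
  exact not_middleHC_of_not_crux h fun m _X D _ _ c hc hH ↦ (hHC D.isSmoothProjective).2 (m + 1) c hc hH

/-- **Ceiling, sibling form.** If the crux fails, the sibling crux LIFT
(`SupersingularIsotypicLift.IsotypicClassesAlgebraic`: all smooth projective `X`, all `p`) fails: the
crux is its term-for-term specialisation to `hX := D.isSmoothProjective`, `p := m + 1`. [folklore] -/
theorem not_lift_of_not_crux (h : ¬ IsotypicMiddleClassesAlgebraic) : ¬ IsotypicClassesAlgebraic := by
  intro hL
  exact h fun μ hμ m X D _h1 _h2 γ hγ ↦ hL μ hμ D.isSmoothProjective (m + 1) γ hγ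

/-- **Bare form ⟹ middle-degree HC on the sector.** If the crux's conclusion is granted for every
FUNCTION `P : H^{2n} → H^{2n}` with `(n,n)` values (no correspondence shape, no linearity, no
rationality preservation), then every rational `(n,n)`-class on the sector is algebraic: take the
constant map `P ≡ c`. So the crux is strictly a statement about the SHAPE of `P`. [folklore] -/
theorem mem_algebraicClasses_of_bare
    (h : ∀ (m : ℕ) (X : Motives.SchemeOver ℂ), UnitaryBallQuotientDatum (2 * (m + 1)) X → 1 ≤ m →
      m ≤ 2 → ∀ P : complexBetti X (2 * (m + 1)) → complexBetti X (2 * (m + 1)),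
        (∀ β, IsOfHodgeType (2 * (m + 1)) X (2 * (m + 1)) (m + 1) (m + 1) (P β)) →
          ∀ c, IsRationalClass c → P c = c → c ∈ algebraicClasses X (m + 1))
    (m : ℕ) (X : Motives.SchemeOver ℂ) (D : UnitaryBallQuotientDatum (2 * (m + 1)) X) (h1 : 1 ≤ m)
    (h2 : m ≤ 2) (c : complexBetti X (2 * (m + 1))) (hc : IsRationalClass c)
    (hH : IsOfHodgeType (2 * (m + 1)) X (2 * (m + 1)) (m + 1) (m + 1) c) :
    c ∈ algebraicClasses X (m + 1) :=
  h m X D h1 h2 (fun _ ↦ c) (fun _ ↦ hH) c hc rfl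

/-- **Floor.** Crux + a SECTOR ENVELOPE (every rational `(n,n)`-class is fixed by some admissible
`P_γ = corrAction μ hX hX rfl γ`, the crux's `P`; sector version of
`SupersingularIsotypicLift.HodgeClassesEnveloped`) ⟹ middle-degree HC on the sector. Over HC the crux,
the envelope and middle-degree HC on the sector are one statement. [cite: Lieberman1968, Thm. 1] -/
theorem mem_algebraicClasses_of_crux_of_enveloped (h : IsotypicMiddleClassesAlgebraic)
    (μ : OrientationFamily) (hμ : μ.HasPoincareDuality)
    (hE : ∀ (m : ℕ) (X : Motives.SchemeOver ℂ) (D : UnitaryBallQuotientDatum (2 * (m + 1)) X),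
      1 ≤ m → m ≤ 2 → ∀ c : complexBetti X (2 * (m + 1)), IsRationalClass c →
        IsOfHodgeType (2 * (m + 1)) X (2 * (m + 1)) (m + 1) (m + 1) c →
          ∃ γ ∈ algebraicClasses (X ⊗ X) (2 * (m + 1)),
            (∀ β, IsRationalClass β → IsRationalClass
              (corrAction μ D.isSmoothProjective D.isSmoothProjective
                (rfl : 2 * (m + 1) + 2 * (2 * (m + 1)) = 2 * (m + 1) + 2 * (2 * (m + 1))) γ β)) ∧
            (∀ β, IsOfHodgeType (2 * (m + 1)) X (2 * (m + 1)) (m + 1) (m + 1)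
              (corrAction μ D.isSmoothProjective D.isSmoothProjective
                (rfl : 2 * (m + 1) + 2 * (2 * (m + 1)) = 2 * (m + 1) + 2 * (2 * (m + 1))) γ β)) ∧
            corrAction μ D.isSmoothProjective D.isSmoothProjective
              (rfl : 2 * (m + 1) + 2 * (2 * (m + 1)) = 2 * (m + 1) + 2 * (2 * (m + 1))) γ c = c)
    (m : ℕ) (X : Motives.SchemeOver ℂ) (D : UnitaryBallQuotientDatum (2 * (m + 1)) X) (h1 : 1 ≤ m)
    (h2 : m ≤ 2) (c : complexBetti X (2 * (m + 1))) (hc : IsRationalClass c)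
    (hH : IsOfHodgeType (2 * (m + 1)) X (2 * (m + 1)) (m + 1) (m + 1) c) :
    c ∈ algebraicClasses X (m + 1) := by
  obtain ⟨γ, hγ, hrat, hhodge, hfix⟩ := hE m X D h1 h2 c hc hH
  exact h μ hμ m X D h1 h2 γ hγ hrat hhodge c hc hfix

/-- **Floor, the route's use.** Crux + `OrthogonalEnveloped` (stmt-HodgeConjecture-14300) ⟹ every
rational `(n,n)`-class cup-orthogonal to the theta world `TW(D)` (special cycles of codimension `n`,
classes on codimension-`m` special cycles, `Hdg^{m,m}_ℚ · N¹`) is algebraic — the kernel half of the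
target `MiddleDegreeStep`. [cite: BergeronMillsonMoeglin2016Balls, Introduction Thm 4] -/
theorem mem_algebraicClasses_of_crux_of_orthogonalEnveloped (h : IsotypicMiddleClassesAlgebraic)
    (hE : OrthogonalEnveloped) (μ : OrientationFamily) (hμ : μ.HasPoincareDuality) (m : ℕ)
    (X : Motives.SchemeOver ℂ) (D : UnitaryBallQuotientDatum (2 * (m + 1)) X) (h1 : 1 ≤ m)
    (h2 : m ≤ 2) (e : complexBetti X (2 * (m + 1))) (he : IsRationalClass e)
    (hH : IsOfHodgeType (2 * (m + 1)) X (2 * (m + 1)) (m + 1) (m + 1) e)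
    (horth : ∀ x ∈ ((⨆ (W : Submodule D.E (Fin (2 * (m + 1) + 1) → D.E))
        (_ : IsTotallyPositive (conjRingHom D.E) D.H W) (_ : Module.finrank D.E W = m + 1),
        classesSupportedOn X (D.specialSubvariety W) (2 * (m + 1))) ⊔
      (⨆ (W : Submodule D.E (Fin (2 * (m + 1) + 1) → D.E))
        (_ : IsTotallyPositive (conjRingHom D.E) D.H W) (_ : Module.finrank D.E W = m)
        (Z : Set X.left) (_ : IsClosed Z) (_ : Z ⊆ D.specialSubvariety W)
        (_ : ∀ z ∈ Z, ((m + 1 : ℕ) : ℕ∞) ≤ Order.coheight z), classesSupportedOn X Z (2 * (m + 1))) ⊔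
      Submodule.span ℂ {z : complexBetti X (2 * (m + 1)) | ∃ a : complexBetti X (2 * m),
        IsRationalClass a ∧ IsOfHodgeType (2 * (m + 1)) X (2 * m) m m a ∧
        ∃ d ∈ algebraicClasses X 1,
          z = cupProduct (two_mul_add_two_mul m 1) a d}),
      cupProduct (two_mul_add_two_mul (m + 1) (m + 1)) e x = 0) :
    e ∈ algebraicClasses X (m + 1) := by
  obtain ⟨γ, hγ, hrat, hhodge, hfix⟩ := hE μ hμ m X D h1 h2 e he hH horth
  exact h μ hμ m X D h1 h2 γ hγ hrat hhodge e he hfix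

end Summit.HodgeConjecture.HodgeConjecture.Theorems.IsotypicMiddleClassesAlgebraic.Negative.NoKillShortOfHC

end
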